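import Summits.QuantumAdvantage.QuantumAdvantage.Theorems.CubicForrelationNearExactIsExactSixteenSplitPrep

/-!
# Crux `CubicForrelation.NearExactIsExact` (stmt-QuantumAdvantage-14043) — tools for the split configuration (sB): four transversal directions
  and the localisation of a `(k+4)`-flat sum (general `n`)

Certificate seat `b2b-cforr-cert` (gen 6).  HONEST FRAMING: bookkeeping lemmas about parametrised flats in `𝔽₂ⁿ` (input to the two-sided exclusion
of the boundary value `Φ = 31/32` on 16 bits) — NOT summit progress.

* `st4_dirs4`: inside a set `U` with `8·#V₀ < #U` there are `t₁, t₂, t₃, t₄ ∈ U` all of whose fifteen non-trivial `⊕`-combinations (right-nested,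
  decreasing indices) avoid `V₀` (greedy, `fl1_avoid`).
* `st4_loc4`: a parametrised `(k+4)`-flat sum whose integrand vanishes on the fifteen translates of the inner `k`-flat equals the inner sum.
* `st4_sum2`, `st4_mem_flatPt2`: the parametrised 2-flat sum written out, and membership of its points in a coset.

References: R. O'Donnell (2014) §3.3 (folklore bookkeeping).  Everything below is proved from Mathlib and the tree; axioms are the standard three.
-/

set_option linter.dupNamespace false -- D-0017: single-problem summit ⇒ `QuantumAdvantage.QuantumAdvantage` by design

noncomputable section

namespace Summit.QuantumAdvantage.QuantumAdvantage.Theorems.CubicForrelation.NearExactIsExact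

open Finset
open Literature.Computability.QuantumComplexity
open Literature.Computability.QuantumComplexity.BuzetChailloux (bxor zeroVec bxor_bxor_cancel_left bxor_zeroVec zeroVec_bxor bxor_comm
  bxor_self)

variable {n : ℕ}

/-- **Four transversal directions inside `U`.** If `8·#V₀ < #U` there are `t₁, t₂, t₃, t₄ ∈ U` whose fifteen non-trivial combinations avoid `V₀`.
[folklore] -/
theorem st4_dirs4 (U V₀ : Finset (Fin n → Bool)) (hcard : 8 * #V₀ < #U) :
    ∃ t₁ ∈ U, ∃ t₂ ∈ U, ∃ t₃ ∈ U, ∃ t₄ ∈ U,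
      t₁ ∉ V₀ ∧ t₂ ∉ V₀ ∧ bxor t₂ t₁ ∉ V₀ ∧ t₃ ∉ V₀ ∧ bxor t₃ t₁ ∉ V₀ ∧ bxor t₃ t₂ ∉ V₀ ∧ bxor t₃ (bxor t₂ t₁) ∉ V₀ ∧
      t₄ ∉ V₀ ∧ bxor t₄ t₁ ∉ V₀ ∧ bxor t₄ t₂ ∉ V₀ ∧ bxor t₄ (bxor t₂ t₁) ∉ V₀ ∧ bxor t₄ t₃ ∉ V₀ ∧ bxor t₄ (bxor t₃ t₁) ∉ V₀ ∧
      bxor t₄ (bxor t₃ t₂) ∉ V₀ ∧ bxor t₄ (bxor t₃ (bxor t₂ t₁)) ∉ V₀ := by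
  have hz : ∀ d : Fin n → Bool, bxor zeroVec d = d := zeroVec_bxor
  have hc : ∀ a b : Fin n → Bool, bxor a b = bxor b a := bxor_comm
  obtain ⟨t₁, h₁U, h₁⟩ := fl1_avoid U V₀ [zeroVec] (by simp only [List.length_singleton]; omega)
  have e₁ : t₁ ∉ V₀ := by simpa only [hz] using h₁ zeroVec (by simp)
  obtain ⟨t₂, h₂U, h₂⟩ := fl1_avoid U V₀ [zeroVec, t₁] (by simp only [List.length_cons, List.length_nil]; omega)
  have e₂ : t₂ ∉ V₀ := by simpa only [hz] using h₂ zeroVec (by simp)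
  have e₂₁ : bxor t₂ t₁ ∉ V₀ := by rw [hc]; exact h₂ t₁ (by simp)
  obtain ⟨t₃, h₃U, h₃⟩ := fl1_avoid U V₀ [zeroVec, t₁, t₂, bxor t₂ t₁]
    (by simp only [List.length_cons, List.length_nil]; omega)
  have e₃ : t₃ ∉ V₀ := by simpa only [hz] using h₃ zeroVec (by simp)
  have e₃₁ : bxor t₃ t₁ ∉ V₀ := by rw [hc]; exact h₃ t₁ (by simp)
  have e₃₂ : bxor t₃ t₂ ∉ V₀ := by rw [hc]; exact h₃ t₂ (by simp)
  have e₃₂₁ : bxor t₃ (bxor t₂ t₁) ∉ V₀ := by rw [hc]; exact h₃ (bxor t₂ t₁) (by simp)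
  obtain ⟨t₄, h₄U, h₄⟩ := fl1_avoid U V₀ [zeroVec, t₁, t₂, bxor t₂ t₁, t₃, bxor t₃ t₁, bxor t₃ t₂, bxor t₃ (bxor t₂ t₁)]
    (by simp only [List.length_cons, List.length_nil]; omega)
  have e₄ : t₄ ∉ V₀ := by simpa only [hz] using h₄ zeroVec (by simp)
  refine ⟨t₁, h₁U, t₂, h₂U, t₃, h₃U, t₄, h₄U, e₁, e₂, e₂₁, e₃, e₃₁, e₃₂, e₃₂₁, e₄, ?_, ?_, ?_, ?_, ?_, ?_, ?_⟩
  · rw [hc]; exact h₄ t₁ (by simp)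
  · rw [hc]; exact h₄ t₂ (by simp)
  · rw [hc]; exact h₄ (bxor t₂ t₁) (by simp)
  · rw [hc]; exact h₄ t₃ (by simp)
  · rw [hc]; exact h₄ (bxor t₃ t₁) (by simp)
  · rw [hc]; exact h₄ (bxor t₃ t₂) (by simp)
  · rw [hc]; exact h₄ (bxor t₃ (bxor t₂ t₁)) (by simp)

/-- **Localisation with four outer directions.** If `F` vanishes at the fifteen translates `q ⊕ t_S` (non-empty `S ⊆ {1,2,3,4}`) of every point
`q` of the inner parametrised `k`-flat, then the parametrised `(k+4)`-flat sum with outer directions `t₁, t₂, t₃, t₄` equals the inner sum.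
[folklore] -/
theorem st4_loc4 {k : ℕ} (F : (Fin n → Bool) → ℤ) (x t₁ t₂ t₃ t₄ : Fin n → Bool) (a : Fin k → Fin n → Bool)
    (h1 : ∀ ε : Fin k → Bool, F (bxor (fun j => x j ^^ decide (Odd #(univ.filter fun i => ε i && a i j))) t₁) = 0)
    (h2 : ∀ ε : Fin k → Bool, F (bxor (fun j => x j ^^ decide (Odd #(univ.filter fun i => ε i && a i j))) t₂) = 0)
    (h21 : ∀ ε : Fin k → Bool, F (bxor (bxor (fun j => x j ^^ decide (Odd #(univ.filter fun i => ε i && a i j))) t₂) t₁) = 0)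
    (h3 : ∀ ε : Fin k → Bool, F (bxor (fun j => x j ^^ decide (Odd #(univ.filter fun i => ε i && a i j))) t₃) = 0)
    (h31 : ∀ ε : Fin k → Bool, F (bxor (bxor (fun j => x j ^^ decide (Odd #(univ.filter fun i => ε i && a i j))) t₃) t₁) = 0)
    (h32 : ∀ ε : Fin k → Bool, F (bxor (bxor (fun j => x j ^^ decide (Odd #(univ.filter fun i => ε i && a i j))) t₃) t₂) = 0)
    (h321 : ∀ ε : Fin k → Bool,
      F (bxor (bxor (bxor (fun j => x j ^^ decide (Odd #(univ.filter fun i => ε i && a i j))) t₃) t₂) t₁) = 0)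
    (h4 : ∀ ε : Fin k → Bool, F (bxor (fun j => x j ^^ decide (Odd #(univ.filter fun i => ε i && a i j))) t₄) = 0)
    (h41 : ∀ ε : Fin k → Bool, F (bxor (bxor (fun j => x j ^^ decide (Odd #(univ.filter fun i => ε i && a i j))) t₄) t₁) = 0)
    (h42 : ∀ ε : Fin k → Bool, F (bxor (bxor (fun j => x j ^^ decide (Odd #(univ.filter fun i => ε i && a i j))) t₄) t₂) = 0)
    (h421 : ∀ ε : Fin k → Bool,
      F (bxor (bxor (bxor (fun j => x j ^^ decide (Odd #(univ.filter fun i => ε i && a i j))) t₄) t₂) t₁) = 0)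
    (h43 : ∀ ε : Fin k → Bool, F (bxor (bxor (fun j => x j ^^ decide (Odd #(univ.filter fun i => ε i && a i j))) t₄) t₃) = 0)
    (h431 : ∀ ε : Fin k → Bool,
      F (bxor (bxor (bxor (fun j => x j ^^ decide (Odd #(univ.filter fun i => ε i && a i j))) t₄) t₃) t₁) = 0)
    (h432 : ∀ ε : Fin k → Bool,
      F (bxor (bxor (bxor (fun j => x j ^^ decide (Odd #(univ.filter fun i => ε i && a i j))) t₄) t₃) t₂) = 0)
    (h4321 : ∀ ε : Fin k → Bool,
      F (bxor (bxor (bxor (bxor (fun j => x j ^^ decide (Odd #(univ.filter fun i => ε i && a i j))) t₄) t₃) t₂) t₁) = 0) :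
    ∑ ε : Fin (k + 4) → Bool, F (fun j => x j ^^ decide (Odd #(univ.filter fun i =>
        ε i && (Matrix.vecCons t₁ (Matrix.vecCons t₂ (Matrix.vecCons t₃ (Matrix.vecCons t₄ a))) : Fin (k + 4) → Fin n → Bool) i j))) =
      ∑ ε : Fin k → Bool, F (fun j => x j ^^ decide (Odd #(univ.filter fun i => ε i && a i j))) := by
  -- outer pair `t₁, t₂` by `sp_loc2` applied to the inner `(k+2)`-vector `t₃ :: t₄ :: a`; its hypotheses follow from peeling `t₃, t₄`
  have inner : ∀ (G : (Fin n → Bool) → ℤ),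
      (∀ ε : Fin k → Bool, G (fun j => x j ^^ decide (Odd #(univ.filter fun i => ε i && a i j))) = 0) →
      (∀ ε : Fin k → Bool, G (bxor (fun j => x j ^^ decide (Odd #(univ.filter fun i => ε i && a i j))) t₃) = 0) →
      (∀ ε : Fin k → Bool, G (bxor (fun j => x j ^^ decide (Odd #(univ.filter fun i => ε i && a i j))) t₄) = 0) →
      (∀ ε : Fin k → Bool, G (bxor (bxor (fun j => x j ^^ decide (Odd #(univ.filter fun i => ε i && a i j))) t₄) t₃) = 0) →
      ∀ ε : Fin (k + 2) → Bool, G (fun j => x j ^^ decide (Odd #(univ.filter fun i =>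
        ε i && (Matrix.vecCons t₃ (Matrix.vecCons t₄ a) : Fin (k + 2) → Fin n → Bool) i j))) = 0 := by
    intro G g0 g3 g4 g43 ε
    -- evaluate pointwise by peeling the two cons layers of the point
    have hpt : (fun j => x j ^^ decide (Odd #(univ.filter fun i =>
        ε i && (Matrix.vecCons t₃ (Matrix.vecCons t₄ a) : Fin (k + 2) → Fin n → Bool) i j))) =
        bxor (bxor (fun j => x j ^^ decide (Odd #(univ.filter fun i => (Fin.tail (Fin.tail ε)) i && a i j)))
          (fun j => ε 1 && t₄ j)) (fun j => ε 0 && t₃ j) := by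
      have e1 : ε = Fin.cons (ε 0) (Fin.tail ε) := (Fin.cons_self_tail ε).symm
      have e2 : Fin.tail ε = Fin.cons (ε 1) (Fin.tail (Fin.tail ε)) := (Fin.cons_self_tail _).symm
      conv_lhs => rw [e1]
      show (fun j => x j ^^ decide (Odd #(univ.filter fun i : Fin (k + 1 + 1) =>
        (Fin.cons (ε 0) (Fin.tail ε) : Fin (k + 2) → Bool) i && (Fin.cons t₃ (Matrix.vecCons t₄ a) : Fin (k + 2) → Fin n → Bool) i j))) = _
      rw [erm_flatPt_cons]
      conv_lhs => rw [e2]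
      show (fun j => (fun j => x j ^^ decide (Odd #(univ.filter fun i : Fin (k + 1) =>
        (Fin.cons (ε 1) (Fin.tail (Fin.tail ε)) : Fin (k + 1) → Bool) i && (Fin.cons t₄ a : Fin (k + 1) → Fin n → Bool) i j))) j ^^
          (ε 0 && t₃ j)) = _
      rw [erm_flatPt_cons]
    rw [hpt]
    cases ε 0 <;> cases ε 1 <;>
      simp only [Bool.true_and, Bool.false_and, es_bxor_false, show (fun j => t₃ j) = t₃ from rfl,
        show (fun j => t₄ j) = t₄ from rfl, g0, g3, g4, g43]
  rw [sp_loc2 F x t₁ t₂ (Matrix.vecCons t₃ (Matrix.vecCons t₄ a))]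
  · rw [sp_loc2 F x t₃ t₄ a h3 h4 h43]
  · exact inner (fun y => F (bxor y t₁)) h1 h31 h41 h431
  · exact inner (fun y => F (bxor y t₂)) h2 h32 h42 h432
  · exact inner (fun y => F (bxor (bxor y t₂) t₁)) h21 h321 h421 h4321

/-- **The parametrised 2-flat sum, written out.** [folklore] -/
theorem st4_sum2 (F : (Fin n → Bool) → ℤ) (x a b : Fin n → Bool) :
    ∑ ε : Fin 2 → Bool, F (fun j => x j ^^ decide (Odd #(univ.filter fun i => ε i && (![a, b] : Fin 2 → Fin n → Bool) i j))) =
      F x + F (bxor x a) + F (bxor x b) + F (bxor (bxor x b) a) := by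
  have p1 := fr_sum_peel F x a ![b]
  have p2 := fr_sum_peel F x b ![]
  have p3 := fr_sum_peel (fun y => F (bxor y a)) x b ![]
  beta_reduce at p3
  rw [p1, p2, p3]
  simp only [Fintype.sum_unique, tep_flatPt_nil]
  ring

/-- The explicit form of a parametrised 2-flat point. [folklore] -/
theorem st4_flatPt_two (b : Fin n → Bool) (a : Fin 2 → Fin n → Bool) (ε : Fin 2 → Bool) :
    (fun j => b j ^^ decide (Odd #(univ.filter fun i => ε i && a i j))) =
      bxor (bxor b (fun j => ε 0 && a 0 j)) (fun j => ε 1 && a 1 j) := by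
  funext j
  rw [card_filter, Fin.sum_univ_two]
  show (b j ^^ decide (Odd ((if (ε 0 && a 0 j) = true then 1 else 0) + (if (ε 1 && a 1 j) = true then 1 else 0)))) =
    ((b j ^^ (ε 0 && a 0 j)) ^^ (ε 1 && a 1 j))
  cases (ε 0 && a 0 j) <;> cases (ε 1 && a 1 j) <;> cases b j <;> decide

/-- Points of a parametrised 2-flat with base in `S` and directions in `V₀` stay in `S`. [folklore] -/
theorem st4_mem_flatPt2 (V₀ : Finset (Fin n → Bool)) (h0 : zeroVec ∈ V₀) (P : (Fin n → Bool) → Prop)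
    (hPV : ∀ x, P x → ∀ a ∈ V₀, P (bxor x a)) {x : Fin n → Bool} (hx : P x) (a : Fin 2 → Fin n → Bool)
    (ha : ∀ i, a i ∈ V₀) (ε : Fin 2 → Bool) :
    P (fun j => x j ^^ decide (Odd #(univ.filter fun i => ε i && a i j))) := by
  rw [st4_flatPt_two]
  exact hPV _ (hPV _ hx _ (fr_smul_mem V₀ h0 (ha 0) _)) _ (fr_smul_mem V₀ h0 (ha 1) _)

end Summit.QuantumAdvantage.QuantumAdvantage.Theorems.CubicForrelation.NearExactIsExact

end
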